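/-
Copyright (c) 2026. All rights reserved.
Released under Apache 2.0 license as described in the file LICENSE.
Authors: abc-iut cell, wave-2 seat abc-iut-L3-t11 (proof-only; Thm 3.7 (iv) and `EdgeLikeDistinct` modulo
(iii) alone, binding the landed discharges of (i) and (ii)).
-/
import Literature.AnabelianGeometry.SemiGraphs.TemperedMaximalCompactProofs
import Literature.AnabelianGeometry.SemiGraphs.TemperedEdgeLikeDistinctOf
import Literature.AnabelianGeometry.SemiGraphs.TemperedVerticialNamedFactsProofs
import Literature.AnabelianGeometry.SemiGraphs.TemperedVerticialDistinctSameVertex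
import HarnessLib

/-!
# [SemiAnbd] Thm 3.7 (iv) and edge-like distinctness from Thm 3.7 (iii) alone

Mochizuki, *Semi-graphs of anabelioids*, Publ. RIMS **42** (2006) [MochizukiSemiAnbd2006], Thm 3.7 p. 40–41.
PROOF-ONLY: with Thm 3.7 (i) `verticialInjective_holds` (abc-iut-L3-t8) and (ii) `verticialDistinct_holds`
(abc-iut-L3-t8) in the tree, the reductions `maximalCompactIffVerticial_of_thm37` and `edgeLikeDistinct_of`
leave Thm 3.7 (iii) `CompactInVerticial` as the ONLY hypothesis of Thm 3.7 (iv) and of `EdgeLikeDistinct`.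
No definitions.
-/

namespace Literature.AnabelianGeometry.SemiGraphs

namespace ProfiniteSemiGraph

universe u

/-- **Thm 3.7 (iv) from Thm 3.7 (iii)** ((i), (ii) discharged in the tree). [cite: MochizukiSemiAnbd2006, Thm 3.7(iv) p.41] -/
theorem maximalCompactIffVerticial_of_compactInVerticial (hCV : CompactInVerticial.{u}) :
    MaximalCompactIffVerticial.{u} :=
  maximalCompactIffVerticial_of_thm37 hCV verticialDistinct_holds verticialInjective_holds

/-- **`EdgeLikeIsInfVerticial` from Thm 3.7 (iii)** ((i), (ii) discharged in the tree).
[cite: MochizukiSemiAnbd2006, Thm 3.7(iv) p.41] -/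
theorem edgeLikeIsInfVerticial_of_compactInVerticial (hCV : CompactInVerticial.{u}) :
    EdgeLikeIsInfVerticial.{u} :=
  edgeLikeIsInfVerticial_of hCV verticialDistinct_holds verticialInjective_holds

/-- **`EdgeLikeDistinct` from Thm 3.7 (iii)** ((i), (ii) discharged in the tree).
[cite: MochizukiSemiAnbd2006, Thm 3.7(iv) p.41] -/
theorem edgeLikeDistinct_of_compactInVerticial (hCV : CompactInVerticial.{u}) : EdgeLikeDistinct.{u} :=
  edgeLikeDistinct_of hCV verticialDistinct_holds verticialInjective_holds

end ProfiniteSemiGraph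

end Literature.AnabelianGeometry.SemiGraphs
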